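import Literature.AlgebraicGeometry.Smoothening.FibreDimension
import Literature.AlgebraicGeometry.Smoothening.NeronDefect
import Literature.AlgebraicGeometry.Smoothening.DefectGenericRank
import Mathlib.LinearAlgebra.Dimension.Torsion.Basic
import Literature.RingTheory.FittingIdeal.PrincipalTorsion
import Literature.RingTheory.FittingIdeal.Functoriality
import Literature.RingTheory.FittingIdeal.FreeModule
import Literature.RingTheory.FittingIdeal.Etale
import Mathlib.RingTheory.QuotSMulTop
import Mathlib.RingTheory.DiscreteValuationRing.Basic
import HarnessLib

/-!
# Boundedness of Néron's measure for the defect of smoothness (BLR 3.3/3)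

Topic: `Literature/AlgebraicGeometry/Smoothening` (Bosch–Lütkebohmert–Raynaud, *Néron Models*,
§3.3, Lemma 3: for a flat `R`-scheme of finite type `X` with smooth generic fibre `X_K` of
dimension `d`, Néron's measure `δ(a)` of the defect of smoothness at the `R'`-valued points `a`
of `X` is bounded). Ring form, through Fitting ideals: for `X = Spec A`,

* smoothness of the generic fibre `A[1/ϖ]` of relative dimension `d` (here: `Ω[A[1/ϖ]⁄R]` free of
  rank `d`) gives `Fitt_d(Ω[A[1/ϖ]⁄R]) = A[1/ϖ]` (`fittingIdeal_eq_top_of_free`), hence, Fitting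
  ideals commuting with localisation, a power `ϖⁿ ∈ Fitt_d(Ω[A⁄R])`
  (`exists_pow_mem_fittingIdeal_of_isLocalization`), and the generic rank of `a*Ω[A⁄R]` is `d`
  at every point `a : A → S` with `ϖ ≠ 0` in `S` (`finrank_tensor_kaehler_eq_of_free_localization`);
* base change of Fitting ideals gives `πⁿ ∈ Fitt_d(a*Ω[A⁄R])` over the discrete valuation ring
  `S`; by Stacks 080Z (`PrincipalTorsion`) the quotient of `M = a*Ω` by its `πᵐ`-torsion, where
  `Fitt_d(M) = (πᵐ)`, `m ≤ n`, is generated by `d = rank M` elements, hence free, so the whole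
  torsion `T` of `M` is killed by `πᵐ` (`torsion_le_torsionBy_of_fittingIdeal_eq`);
* a module `T` killed by `πᵐ` has `ℓ(T) ≤ m · ℓ(T/πT)` (`length_le_mul_length_quotSMulTop`), and
  `ℓ(T/πT) = ℓ(M/πM) - d ≤ N - d` for `M` generated by `N` elements (`FibreDimension`);

so `δ(a) = ℓ(T) ≤ n (N - d)` uniformly in the point (`neronDefect_le_of_pow_mem_fittingIdeal`,
`exists_bound_neronDefect`). [folklore] reconstruction (the source is not held); no named facts
(D-0026).

## References

* S. Bosch, W. Lütkebohmert, M. Raynaud, *Néron Models*, Springer 1990, §3.3, Lemma 3.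
  [BLRNeronModels1990] (Not held; number only.)
* The Stacks Project, Tags 07ZA, 080Z. [StacksProject]
-/

noncomputable section

open scoped Pointwise TensorProduct
open Module Submodule Function KaehlerDifferential
open Literature.RingTheory.FittingIdeal

namespace Literature.AlgebraicGeometry.Smoothening

universe u v

/-! ## A module killed by `xᵐ` has length at most `m · ℓ(Y/xY)` -/

section Length

variable {S : Type u} [CommRing S] (x : S)

/-- If `xᵐ Y = 0` then `ℓ(Y) ≤ m · ℓ(Y/xY)`: filter `Y ⊇ xY ⊇ x²Y ⊇ ⋯ ⊇ xᵐY = 0` and use the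
surjections `Y/xY ↠ xⁱY/xⁱ⁺¹Y`. [folklore] -/
theorem length_le_mul_length_quotSMulTop :
    ∀ (m : ℕ) (Y : Type v) [AddCommGroup Y] [Module S Y], (∀ y : Y, x ^ m • y = 0) →
      Module.length S Y ≤ m * Module.length S (QuotSMulTop x Y) := by
  intro m
  induction m with
  | zero =>
    intro Y _ _ hY
    have : Subsingleton Y := ⟨fun a b => by
      have ha := hY a
      have hb := hY b
      rw [pow_zero, one_smul] at ha hb
      rw [ha, hb]⟩
    rw [Module.length_eq_zero_iff.mpr this]
    exact zero_le
  | succ m ih =>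
    intro Y _ _ hY
    -- `P = xY` is killed by `xᵐ`
    let P : Submodule S Y := x • ⊤
    have hP : ∀ p : P, x ^ m • p = 0 := by
      rintro ⟨p, hp⟩
      obtain ⟨y, -, rfl⟩ := (Submodule.mem_smul_pointwise_iff_exists p x ⊤).mp hp
      apply Subtype.ext
      change x ^ m • (x • y) = 0
      rw [smul_smul, ← pow_succ, hY]
    -- `ℓ(Y) = ℓ(xY) + ℓ(Y/xY)`
    have hexact := Module.length_eq_add_of_exact P.subtype P.mkQ P.injective_subtype
      (Submodule.mkQ_surjective P) (LinearMap.exact_subtype_mkQ P)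
    -- the surjection `Y ↠ xY`, `y ↦ xy`, induces `Y/xY ↠ xY/x²Y`
    let ψ : Y →ₗ[S] P := (x • (LinearMap.id : Y →ₗ[S] Y)).codRestrict P fun y =>
      Submodule.smul_mem_pointwise_smul y x ⊤ Submodule.mem_top
    have hψ : Function.Surjective ψ := by
      rintro ⟨p, hp⟩
      obtain ⟨y, -, rfl⟩ := (Submodule.mem_smul_pointwise_iff_exists p x ⊤).mp hp
      exact ⟨y, Subtype.ext rfl⟩
    have hle : Module.length S (QuotSMulTop x P) ≤ Module.length S (QuotSMulTop x Y) :=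
      Module.length_le_of_surjective (QuotSMulTop.map x ψ) (QuotSMulTop.map_surjective x hψ)
    have hih : Module.length S P ≤ m * Module.length S (QuotSMulTop x Y) :=
      (ih P hP).trans (by gcongr)
    calc Module.length S Y = Module.length S P + Module.length S (QuotSMulTop x Y) := hexact
      _ ≤ m * Module.length S (QuotSMulTop x Y) + Module.length S (QuotSMulTop x Y) :=
          add_le_add hih le_rfl
      _ = ((m + 1 : ℕ) : ℕ∞) * Module.length S (QuotSMulTop x Y) := by push_cast; ring

end Length

/-! ## Over a discrete valuation ring: the torsion is killed by `Fitt_{rank}` -/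

section DVR

variable {S : Type u} [CommRing S] [IsDomain S] [IsDiscreteValuationRing S] {π : S}
  (M : Type v) [AddCommGroup M] [Module S M] [Module.Finite S M]

omit [IsDiscreteValuationRing S] in
/-- If `Fitt_d(M) = (f)` with `d = rank M` and `f ≠ 0`, over a local domain, then the torsion of
`M` is killed by `f`: by Stacks 080Z the quotient `M/M[f]` is generated by `d` elements, and it
has rank `d`, so it is free and the torsion of `M` dies in it.
[cite: StacksProject, Tag 080Z] -/
theorem torsion_le_torsionBy_of_fittingIdeal_eq [IsLocalRing S] [IsNoetherianRing S] {d : ℕ}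
    (hd : finrank S M = d) {f : S} (hf : f ≠ 0)
    (h : Module.fittingIdeal S M d = Ideal.span {f}) : torsion S M ≤ torsionBy S M f := by
  classical
  obtain ⟨y, hy⟩ := Module.exists_span_eq_top_quotient_torsionBy (R := S) (M := M) h
  have hT : torsionBy S M f ≤ torsion S M := fun t ht =>
    (mem_torsion_iff t).mpr ⟨⟨f, mem_nonZeroDivisors_of_ne_zero hf⟩, (mem_torsionBy_iff f t).mp ht⟩
  -- `M/M[f]` has rank `d`
  have hrank : finrank S (M ⧸ torsionBy S M f) = d := by
    rw [finrank, rank_quotient_eq_of_le_torsion hT, ← finrank, hd]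
  -- the surjection `S^d ↠ M/M[f]` given by the `d` generators
  let Φ : (Fin d → S) →ₗ[S] M ⧸ torsionBy S M f := Fintype.linearCombination S y
  have hΦ : Function.Surjective Φ := by
    rw [← LinearMap.range_eq_top, Fintype.range_linearCombination, hy]
  -- its kernel has rank `0`, hence is torsion, hence zero inside `S^d`
  have hker : LinearMap.ker Φ = ⊥ := by
    have h1 := Submodule.finrank_quotient_add_finrank (LinearMap.ker Φ)
    rw [(Φ.quotKerEquivOfSurjective hΦ).finrank_eq, hrank, Module.finrank_fin_fun] at h1
    have h0 : finrank S (LinearMap.ker Φ) = 0 := by omega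
    rw [Module.finrank_eq_zero_iff_isTorsion] at h0
    rw [eq_bot_iff]
    intro v hv
    obtain ⟨c, hc⟩ := @h0 ⟨v, hv⟩
    have hcv : (c : S) • v = 0 := congrArg Subtype.val hc
    have hreg : IsRegular (c : S) := IsRegular.of_ne_zero (nonZeroDivisors.coe_ne_zero c)
    exact (mem_bot S).mpr (hreg.smul_right_injective (Fin d → S) (hcv.trans (smul_zero _).symm))
  -- so `M/M[f] ≅ S^d` is torsion-free
  let e : (Fin d → S) ≃ₗ[S] M ⧸ torsionBy S M f :=
    LinearEquiv.ofBijective Φ ⟨LinearMap.ker_eq_bot.mp hker, hΦ⟩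
  haveI : Module.Free S (M ⧸ torsionBy S M f) := Module.Free.of_equiv e
  -- and the torsion of `M` maps to zero in it
  intro t ht
  obtain ⟨a, ha⟩ := (mem_torsion_iff t).mp ht
  have h1 : (a : S) • (torsionBy S M f).mkQ t = 0 := by
    rw [← map_smul]
    exact (congrArg (torsionBy S M f).mkQ ha).trans (map_zero _)
  have hreg : IsRegular (a : S) := IsRegular.of_ne_zero (nonZeroDivisors.coe_ne_zero a)
  have h2 : (torsionBy S M f).mkQ t = 0 :=
    hreg.smul_right_injective (M ⧸ torsionBy S M f) (h1.trans (smul_zero _).symm)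
  exact (Submodule.Quotient.mk_eq_zero _).mp h2

/-- **The torsion is controlled by `Fitt_{rank}`**: over a discrete valuation ring with
uniformizer `π`, if `πⁿ ∈ Fitt_d(M)`, `d = rank M`, then `ℓ(T) ≤ n · ℓ(T/πT)` for the torsion
submodule `T` of `M` (`Fitt_d(M) = (πᵐ)` with `m ≤ n` kills `T`). [folklore] -/
theorem length_torsion_le_mul_of_pow_mem_fittingIdeal (hπ : Irreducible π) {d n : ℕ}
    (hd : finrank S M = d) (h : π ^ n ∈ Module.fittingIdeal S M d) :
    Module.length S (torsion S M) ≤ n * Module.length S (QuotSMulTop π (torsion S M)) := by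
  have hne : Module.fittingIdeal S M d ≠ ⊥ := fun h0 => by
    rw [h0, Ideal.mem_bot] at h
    exact pow_ne_zero n hπ.ne_zero h
  obtain ⟨m, hm⟩ := IsDiscreteValuationRing.ideal_eq_span_pow_irreducible hne hπ
  have hmn : m ≤ n := by
    rw [hm, Ideal.mem_span_singleton] at h
    exact (pow_dvd_pow_iff hπ.ne_zero hπ.not_isUnit).mp h
  have hT := torsion_le_torsionBy_of_fittingIdeal_eq M hd (pow_ne_zero m hπ.ne_zero) hm
  have hkill : ∀ t : torsion S M, π ^ m • t = 0 := fun t => Subtype.ext (by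
    rw [SetLike.val_smul, ZeroMemClass.coe_zero]
    exact (mem_torsionBy_iff _ _).mp (hT t.2))
  calc Module.length S (torsion S M) ≤ m * Module.length S (QuotSMulTop π (torsion S M)) :=
        length_le_mul_length_quotSMulTop π m _ hkill
    _ ≤ n * Module.length S (QuotSMulTop π (torsion S M)) := by gcongr

/-- With `N` generators: `ℓ(T) ≤ n (N - d)`, since `ℓ(T/πT) = ℓ(M/πM) - d ≤ N - d`
(`length_quotSMulTop_eq_finrank_add`). [folklore] -/
theorem length_torsion_le_of_pow_mem_fittingIdeal (hπ : Irreducible π) {d n N : ℕ}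
    (hd : finrank S M = d) (h : π ^ n ∈ Module.fittingIdeal S M d) (v : Fin N → M)
    (hv : span S (Set.range v) = ⊤) :
    Module.length S (torsion S M) ≤ (n * (N - d) : ℕ) := by
  have h1 := length_torsion_le_mul_of_pow_mem_fittingIdeal M hπ hd h
  have h2 := length_quotSMulTop_eq_finrank_add M hπ
  -- `ℓ(M/πM) ≤ N`
  have h3 : Module.length S (QuotSMulTop π M) ≤ N := by
    have hkill : ∀ y : QuotSMulTop π M, π • y = 0 := fun y =>
      Module.mem_annihilator.mp (QuotSMulTop.mem_annihilator (M := M) π) y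
    have h := length_span_le_card hπ hkill ((π • (⊤ : Submodule S M)).mkQ ∘ v)
    rwa [Set.range_comp, Submodule.span_image, hv, Submodule.map_top, Submodule.range_mkQ,
      Module.length_top, Fintype.card_fin] at h
  -- pass to natural numbers
  have hfin : Module.length S (QuotSMulTop π (torsion S M)) ≠ ⊤ := by
    intro htop
    rw [htop, add_top] at h2
    rw [h2] at h3
    exact ENat.coe_ne_top N (top_le_iff.mp h3)
  obtain ⟨l, hl⟩ := ENat.ne_top_iff_exists.mp hfin
  rw [← hl] at h1 h2
  rw [h2, hd] at h3
  have h4 : d + l ≤ N := by exact_mod_cast h3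
  calc Module.length S (torsion S M) ≤ n * l := by exact_mod_cast h1
    _ ≤ ((n * (N - d) : ℕ) : ℕ∞) := by exact_mod_cast Nat.mul_le_mul_left n (by omega)

end DVR

/-! ## Ring form: `δ(a) ≤ n (N - d)` -/

section Ring

variable (R : Type u) [CommRing R] (ϖ : R) (A : Type u) [CommRing A] [Algebra R A]
  (S : Type u) [CommRing S] [IsDomain S] [IsDiscreteValuationRing S] [Algebra R S] [Algebra A S]
  [IsScalarTower R A S]

/-- **`δ(a) ≤ n (N - d)`**: if `ϖⁿ ∈ Fitt_d(Ω[A⁄R])`, `Ω[A⁄R]` is generated by `N` elements and the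
point `a : A → S` (a discrete valuation ring in which `ϖ` is a uniformizer) has
`rank_S a*Ω[A⁄R] = d`, then `δ(a) ≤ n (N - d)` — a bound depending only on `X = Spec A`, not on
the point. [folklore] -/
theorem neronDefect_le_of_pow_mem_fittingIdeal (hπ : Irreducible (algebraMap R S ϖ)) {d n N : ℕ}
    (hfit : algebraMap R A ϖ ^ n ∈ Module.fittingIdeal A Ω[A⁄R] d)
    (hd : finrank S (S ⊗[A] Ω[A⁄R]) = d) (ω : Fin N → Ω[A⁄R])
    (hω : span A (Set.range ω) = ⊤) : neronDefect R A S ≤ (n * (N - d) : ℕ) := by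
  haveI : Module.Finite A Ω[A⁄R] :=
    ⟨Submodule.fg_def.mpr ⟨Set.range ω, Set.finite_range ω, hω⟩⟩
  -- `πⁿ ∈ Fitt_d(S ⊗ Ω)`
  have h1 : algebraMap R S ϖ ^ n ∈ Module.fittingIdeal S (S ⊗[A] Ω[A⁄R]) d := by
    have := Module.map_fittingIdeal_le_baseChange (R := A) (M := Ω[A⁄R]) S d
      (Ideal.mem_map_of_mem (algebraMap A S) hfit)
    rwa [map_pow, ← IsScalarTower.algebraMap_apply] at this
  -- the generators `1 ⊗ ωᵢ`
  have h2 : span S (Set.range fun i => (1 : S) ⊗ₜ[A] ω i) = ⊤ := by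
    have h := Submodule.baseChange_span (R := A) (M := Ω[A⁄R]) (A := S) (Set.range ω)
    rw [hω, Submodule.baseChange_top] at h
    have hr : Set.range (fun i => (1 : S) ⊗ₜ[A] ω i) =
        TensorProduct.mk A S Ω[A⁄R] 1 '' Set.range ω := by
      ext z
      simp only [Set.mem_range, Set.mem_image, TensorProduct.mk_apply, exists_exists_eq_and]
    rw [hr]
    exact h.symm
  exact length_torsion_le_of_pow_mem_fittingIdeal (S ⊗[A] Ω[A⁄R]) hπ hd h1 _ h2

variable (A' : Type u) [CommRing A'] [Algebra A A'] [Algebra R A'] [IsScalarTower R A A']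
  [IsLocalization.Away (algebraMap R A ϖ) A']

/-- **A power of `ϖ` lies in `Fitt_d(Ω[A⁄R])` as soon as `Fitt_d(Ω[A[1/ϖ]⁄R]) = A[1/ϖ]`** (Fitting
ideals commute with localisation, Stacks 07ZA). [cite: StacksProject, Tag 07ZA] -/
theorem exists_pow_mem_fittingIdeal_of_isLocalization [Module.Finite A Ω[A⁄R]] {d : ℕ}
    (h : Module.fittingIdeal A' Ω[A'⁄R] d = ⊤) :
    ∃ n, algebraMap R A ϖ ^ n ∈ Module.fittingIdeal A Ω[A⁄R] d := by
  have h1 := Module.fittingIdeal_kaehlerDifferential_of_isLocalization' (A := R) (B := A)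
    (B' := A') (Submonoid.powers (algebraMap R A ϖ)) d
  rw [h] at h1
  have h2 : (1 : A') ∈ (Module.fittingIdeal A Ω[A⁄R] d).map (algebraMap A A') :=
    h1 ▸ Submodule.mem_top
  obtain ⟨⟨⟨i, hi⟩, ⟨s, hs⟩⟩, his⟩ :=
    (IsLocalization.mem_map_algebraMap_iff (Submonoid.powers (algebraMap R A ϖ)) A').mp h2
  simp only [one_mul] at his
  obtain ⟨⟨c, hc⟩, hcs⟩ :=
    (IsLocalization.eq_iff_exists (Submonoid.powers (algebraMap R A ϖ)) A').mp his
  simp only at hcs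
  obtain ⟨k, rfl⟩ := (Submonoid.mem_powers_iff _ _).mp hs
  obtain ⟨j, rfl⟩ := (Submonoid.mem_powers_iff _ _).mp hc
  exact ⟨j + k, by rw [pow_add, hcs]; exact Ideal.mul_mem_left _ _ hi⟩

/-- If `Ω[A'⁄R]` is free of rank `d` then `Fitt_d(Ω[A'⁄R]) = A'` (Stacks 07Z7).
[cite: StacksProject, Tag 07Z7] -/
theorem fittingIdeal_eq_top_of_free (B : Type u) [CommRing B] [Nontrivial B] [Algebra R B]
    [Module.Free B Ω[B⁄R]] [Module.Finite B Ω[B⁄R]] :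
    Module.fittingIdeal B Ω[B⁄R] (finrank B Ω[B⁄R]) = ⊤ := by
  rw [Module.fittingIdeal_of_basis (Module.finBasisOfFinrankEq B Ω[B⁄R] rfl), if_pos le_rfl]

/-- **The generic rank of `a*Ω[A⁄R]` is the rank of `Ω` on the generic fibre**: for a point
`a : A → S` with values in a domain in which `ϖ ≠ 0` and `Ω[A[1/ϖ]⁄R]` free,
`rank_S (S ⊗_A Ω[A⁄R]) = rank Ω[A[1/ϖ]⁄R]` (the fraction field of `S` is an
`A[1/ϖ]`-algebra). [folklore] -/
theorem finrank_tensor_kaehler_eq_of_free_localization [Nontrivial A'] [Module.Free A' Ω[A'⁄R]]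
    (hϖ : algebraMap R S ϖ ≠ 0) : finrank S (S ⊗[A] Ω[A⁄R]) = finrank A' Ω[A'⁄R] := by
  let K := FractionRing S
  have hunit : IsUnit (algebraMap A K (algebraMap R A ϖ)) := by
    rw [isUnit_iff_ne_zero, IsScalarTower.algebraMap_apply A S K, ← IsScalarTower.algebraMap_apply
      R A S]
    exact (map_ne_zero_iff _ (IsFractionRing.injective S K)).mpr hϖ
  letI : Algebra A' K :=
    (IsLocalization.Away.lift (algebraMap R A ϖ) hunit : A' →+* K).toAlgebra
  haveI : IsScalarTower A A' K := IsScalarTower.of_algebraMap_eq fun a =>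
    (IsLocalization.Away.lift_eq (S := A') (algebraMap R A ϖ) hunit a).symm
  have e : K ⊗[S] (S ⊗[A] Ω[A⁄R]) ≃ₗ[K] K ⊗[A'] Ω[A'⁄R] :=
    (TensorProduct.AlgebraTensorModule.cancelBaseChange A S K K Ω[A⁄R]).trans
      (tensorKaehlerEquivOfIsLocalization R A A' (Submonoid.powers (algebraMap R A ϖ)) K)
  rw [← finrank_fractionRing_tensor S (S ⊗[A] Ω[A⁄R]), e.finrank_eq, Module.finrank_baseChange]

/-- **BLR 3.3/3 — `δ` is bounded when the generic fibre is smooth**, ring form: if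
`Ω[A[1/ϖ]⁄R]` is free (of rank `d`, e.g. `X_K` a smooth group scheme, or any smooth `X_K` after
shrinking) and `Ω[A⁄R]` is finitely generated, there is a bound `c`, depending only on
`X = Spec A`, with `δ(a) ≤ c` for every point `a` of `X` with values in a discrete valuation
ring `S` over `R` in which `ϖ` is a uniformizer. [folklore] -/
theorem exists_bound_neronDefect [Module.Finite A Ω[A⁄R]] [Module.Free A' Ω[A'⁄R]] :
    ∃ c : ℕ, ∀ (S : Type u) [CommRing S] [IsDomain S] [IsDiscreteValuationRing S] [Algebra R S]
      [Algebra A S] [IsScalarTower R A S], Irreducible (algebraMap R S ϖ) →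
        neronDefect R A S ≤ c := by
  rcases subsingleton_or_nontrivial A' with hA' | hA'
  · -- `A[1/ϖ] = 0`: `ϖ` is nilpotent in `A`, so there are no such points at all
    obtain ⟨⟨m, hm⟩, hm0⟩ :=
      (IsLocalization.map_eq_zero_iff (Submonoid.powers (algebraMap R A ϖ)) A' (1 : A)).mp
        (Subsingleton.elim _ _)
    obtain ⟨n, rfl⟩ := (Submonoid.mem_powers_iff _ _).mp hm
    simp only [mul_one] at hm0
    refine ⟨0, fun S _ _ _ _ _ _ hπ => ?_⟩
    exfalso
    apply pow_ne_zero n hπ.ne_zero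
    rw [IsScalarTower.algebraMap_apply R A S, ← map_pow, hm0, map_zero]
  haveI : Module.Finite A' Ω[A'⁄R] := by
    haveI : IsLocalizedModule (Submonoid.powers (algebraMap R A ϖ))
        (KaehlerDifferential.map R R A A') := inferInstance
    exact Module.Finite.of_isLocalizedModule (Submonoid.powers (algebraMap R A ϖ))
      (KaehlerDifferential.map R R A A')
  obtain ⟨n, hn⟩ := exists_pow_mem_fittingIdeal_of_isLocalization R ϖ A A'
    (fittingIdeal_eq_top_of_free R A')
  obtain ⟨N, ω, hω⟩ := Module.Finite.exists_fin (R := A) (M := Ω[A⁄R])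
  refine ⟨n * (N - finrank A' Ω[A'⁄R]), fun S _ _ _ _ _ _ hπ => ?_⟩
  exact_mod_cast neronDefect_le_of_pow_mem_fittingIdeal R ϖ A S hπ hn
    (finrank_tensor_kaehler_eq_of_free_localization R ϖ A S A' hπ.ne_zero) ω hω

end Ring

end Literature.AlgebraicGeometry.Smoothening

end
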